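import Mathlib
import HarnessLib
import Summits.HubbardSuperconductivity.HubbardSuperconductivity.Theorems.KLProgrammeKLRegimeTwoVolumeSourceFamilySmoothRows
import Summits.HubbardSuperconductivity.HubbardSuperconductivity.Theorems.KLProgrammeKLRegimeTwoVolumeSourceSmoothKit
import Summits.HubbardSuperconductivity.HubbardSuperconductivity.Theorems.KLProgrammeKLRegimeTwoVolumeSourceSmoothAnalysis

/-!
# Route `KLProgramme` — crux K3, VL child (stmt-HubbardSuperconductivity-20440), keying «(VL)-SRC-WINDOW» (R227)/(R236) (β), lemma (N2) INSTANTIATED: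
# the ε-weighted, `(1 + Λ_n‖y‖_𝕋)`-weighted rows of the WINDOWED two-leg kernel `W^χ_V` are paid by token #24 at every pin time, times `C_W²`
# (k3c4-p1 g17's ask, KL STATUS 17:19Z)

Cell gate-hubbard-kl, seat p1 g22.  `…TwoVolumeSourceFamilySmoothRows.weightedRows_family_le_of_smooth` (p651718) at `S := srcSmoothKernel M`,
`F := srcWindowFamily V M` (eigen-relation `…SourceSmoothAnalysis.sum_srcSmoothKernel_mul_hubbardPlaneWave`, p652196; `ℓ¹` constant
`…SourceSmoothKit.exists_srcSmoothKernel_l1_bound`, p652020), the plain rows at pin `(τ, o⃗)` read from `…TwoVolumeSourceReadout.weightedRows_le_klSrcPinnedSum`: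
* **`exists_windowedWeightedRows_le`** — `∃ C ≥ 0` (`= C_W²`, `M`-, `V`-, `β`-free) such that for `0 < β`, every pin `o`, every `B`:
  `(∀ τ, klSrcPinnedSum V M β U μ K n 2 2 0 (((τ,o⃗),(0,↑,+)),1) ≤ B) → ε·Σ_{t₁,y}(1 + Λ_n‖y‖_𝕋)·‖W^χ_V(o,(t₁,o⃗+y))‖ ≤ C·B`
  (`W^χ_V = sectorisedKernel V M β (srcWindowFamily V M) 𝒱⁽ⁿ⁾_V[K] 2 ((0,0,+),(0,0,−))`, `ε = imagTimeWeight β M`, `Λ_n = klScale klE0 n`).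

Proofs only; no definition; nothing asserts HB1W, (β), any VL stub, K3 or superconductivity.
References: BGM 2006 §2.9 (4.6)–(4.8) [cite: BenfattoGiulianiMastropietro2006]; Salmhofer 1999 App. B.5.5 [cite: Salmhofer1999].
-/

noncomputable section

namespace Summit.HubbardSuperconductivity.HubbardSuperconductivity.Theorems.TwoVolumeSource

set_option linter.dupNamespace false -- summit = problem name (single-conjunct summit), D-0017

open Finset Literature.MathematicalPhysics.QuantumLattice Literature.Probability.LatticeModels GrassmannAlgebra
open Summit.HubbardSuperconductivity.HubbardSuperconductivity.Theorems.KLProgrammeLegKernels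
open Summit.HubbardSuperconductivity.HubbardSuperconductivity.Theorems.KLRegimeSplit
open Summit.HubbardSuperconductivity.HubbardSuperconductivity.Theorems.TwoVolumeDefect

/-- **THE WINDOWED WEIGHTED ROWS ARE PAID BY TOKEN #24 AT EVERY PIN TIME, TIMES `C_W²`.** [cite: BenfattoGiulianiMastropietro2006, §2.9 (4.6)-(4.8)] -/
theorem exists_windowedWeightedRows_le :
    ∃ C : ℝ, 0 ≤ C ∧ ∀ (L M : ℕ) [NeZero L] [NeZero M] (β : ℝ), 0 < β → ∀ (U μ : ℝ) (K : TrigPolyC4v) (n : ℕ) (o : SpaceTimeIdx L M) (B : ℝ),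
      (∀ τ : ImagTimeIdx M, klSrcPinnedSum L M β U μ K n 2 2 0 (((τ, o.2), ((⟨0, sectorCount_pos n⟩, 0), 0)), 1) ≤ B) →
        imagTimeWeight β M * ∑ t₁ : ImagTimeIdx M, ∑ y : TorusSite 2 L,
            (1 + klScale klE0 n * (Torus.tnorm y : ℝ)) *
              ‖sectorisedKernel L M β (srcWindowFamily L M) (klEffectiveAction L M β U μ K klE0 n) 2
                  (![((0, 0), 0), ((0, 0), 1)] : Fin 2 → SectorLeg 1) ![o, (t₁, o.2 + y)]‖ ≤ C * B := by
  obtain ⟨Cw, hCw0, hrow, hcol⟩ := exists_srcSmoothKernel_l1_bound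
  refine ⟨Cw * Cw, mul_nonneg hCw0 hCw0, fun L M _ _ β hβ U μ K n o B hB => ?_⟩
  set ε := imagTimeWeight β M with hε_def
  set Λ := klScale klE0 n with hΛ_def
  have hM : (0 : ℝ) < M := Nat.cast_pos.2 (Nat.pos_of_ne_zero (NeZero.ne M))
  have hε : 0 < ε := by rw [hε_def]; unfold imagTimeWeight; positivity
  have hΛ : 0 ≤ Λ := (klth_klScale_pos n).le
  -- the plain rows at every pin time, in the currency of `weightedRows_family_le_of_smooth`
  have hplain : ∀ τ₀ : ImagTimeIdx M, ∑ τ₁ : ImagTimeIdx M, ∑ y ∈ (univ : Finset (TorusSite 2 L)), (1 + Λ * (Torus.tnorm y : ℝ)) *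
      ‖sectorisedKernel L M β (trivialMultiplier L M) (klEffectiveAction L M β U μ K klE0 n) 2
          (![((0, 0), 0), ((0, 0), 1)] : Fin 2 → SectorLeg 1) ![(τ₀, o.2), (τ₁, o.2 + y)]‖ ≤ B / ε := by
    intro τ₀
    rw [le_div_iff₀ hε, mul_comm]
    exact (weightedRows_le_klSrcPinnedSum hβ.le U μ K n ((τ₀, o.2) : SpaceTimeIdx L M)).trans (hB τ₀)
  -- the eigen-relation of the window
  have hS : ∀ (c : Fin 2) (k : FreqMomentum L M) (τ : ImagTimeIdx M) (x : TorusSite 2 L),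
      ∑ τ' : ImagTimeIdx M, srcSmoothKernel M c τ τ' * hubbardPlaneWave L M β c k (τ', x) =
        srcWindowFamily L M 0 k * hubbardPlaneWave L M β c k (τ, x) := fun c k τ x =>
    sum_srcSmoothKernel_mul_hubbardPlaneWave hβ.ne' c k τ x
  have hF := weightedRows_family_le_of_smooth β (fun c => srcSmoothKernel M c) (srcWindowFamily L M) hS
    (fun c τ => hrow M c τ) (fun c τ' => hcol M c τ') (klEffectiveAction L M β U μ K klE0 n)
    (![((0, 0), 0), ((0, 0), 1)] : Fin 2 → SectorLeg 1) o univ (w := fun y => 1 + Λ * (Torus.tnorm y : ℝ)) (fun y => by positivity) (hplain)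
  calc ε * ∑ t₁ : ImagTimeIdx M, ∑ y : TorusSite 2 L, (1 + Λ * (Torus.tnorm y : ℝ)) *
          ‖sectorisedKernel L M β (srcWindowFamily L M) (klEffectiveAction L M β U μ K klE0 n) 2
              (![((0, 0), 0), ((0, 0), 1)] : Fin 2 → SectorLeg 1) ![o, (t₁, o.2 + y)]‖
      ≤ ε * (Cw * Cw * (B / ε)) := mul_le_mul_of_nonneg_left hF hε.le
    _ = Cw * Cw * B := by field_simp

end Summit.HubbardSuperconductivity.HubbardSuperconductivity.Theorems.TwoVolumeSource

end
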